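import Summits.BirchSwinnertonDyer.BirchSwinnertonDyer.Theses.GenusKolyvaginAtTwo
import Summits.BirchSwinnertonDyer.BirchSwinnertonDyer.Theorems.GenusKolyvaginAtTwoCyclicTorsionOfNegDisc
import Summits.BirchSwinnertonDyer.BirchSwinnertonDyer.Theorems.GenusKolyvaginAtTwoEquivariantChebotarevAtTwoOffDiscField
import HarnessLib

/-!
# Route `GenusKolyvaginAtTwo`, crux 22137 `KolyvaginExactAtTwo`: the LINE-6 split glue RE-THREADED
# through Q5R `EquivariantChebotarevAtTwoR` (turnkey for the pen; seat gk2-p3 g11)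

State of the split after route rev 13. The gen-1 split of crux stmt-BirchSwinnertonDyer-22137
`KolyvaginExactAtTwo` is {Q1 `CyclicTorsionOfNegDisc` (24879, PROVED), Q2 `KolyvaginRelationAtTwo` (24880),
Q5 `EquivariantChebotarevAtTwo` (24881, REFUTED as typed: `GenusExact.not_EquivariantChebotarevAtTwo`, witness
`433a1 / ℚ(√−433)`), Q3 `EquivariantKolyvaginExactAtTwo` (24882, KEY; := Q2 → Q5 → Q1-clause → parent on
`Δ < 0`, hence VACUOUS as typed since Q5 is false), Q4 `KolyvaginExactAtTwoPosDisc` (24883, residual)} with the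
glue `KolyvaginExactAtTwoOfSplit` (24884, proved — but it consumes the refuted Q5, so it can never be fed).
Rev 13 filed the repair Q5R `EquivariantChebotarevAtTwoR` (27280 = Q5 + the parent's binder
`¬ IsSquare (d_K · (−|Δ_E|))`; closed by name from `GenusExact.equivariantChebotarevAtTwo_of_not_isSquare`,
p606279) and left the re-typing of Q3 and of the glue to a later revision.

This file lands, IN ADVANCE and BY PURE LOGIC, the two statements the pen needs, with Q3R := Q3 VERBATIM except
that its antecedent `EquivariantChebotarevAtTwo` is replaced by `EquivariantChebotarevAtTwoR` (spelled out in
full below, because the route file does not yet declare it):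

* `kolyvaginExactAtTwo_of_splitR` — **glueR**: `CyclicTorsionOfNegDisc → KolyvaginRelationAtTwo →
  EquivariantChebotarevAtTwoR → Q3R → KolyvaginExactAtTwoPosDisc → KolyvaginExactAtTwo` (case on the sign of
  `Δ(W) ≠ 0`, as in the rev-12 glue). If the pen files the glue item with this text, its closer is
  `exact kolyvaginExactAtTwo_of_splitR`.
* `kolyvaginExactAtTwo_of_Q2_Q3R_Q4` — **the parent crux modulo its OPEN children only**:
  `KolyvaginRelationAtTwo → Q3R → KolyvaginExactAtTwoPosDisc → KolyvaginExactAtTwo`, with Q1 discharged by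
  `GenusCyclicTorsion.cyclicTorsionOfNegDisc_proof` and Q5R by `GenusExact.equivariantChebotarevAtTwo_of_not_isSquare`.

HONEST FRAMING. Theorems only (no definition, no named fact, no `sorry`); nothing here proves Q2, Q3R or Q4, let
alone the crux or BSD. Q3R is this seat's reading of the minimal repair (the parent `KolyvaginExactAtTwo` carries
the binder `¬ IsSquare (d_K · (−|Δ|))` that Q5R asks for, so Q3R's inner statement is fed exactly as before).

References: [McCallumLMS1991] §3 Cor. 3.2, §5; [GrossLMS1991] §9; [Kolyvagin1989] Thm. B.
-/

set_option autoImplicit false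
set_option linter.dupNamespace false

namespace Summit.BirchSwinnertonDyer.BirchSwinnertonDyer.Theorems.GenusExact

open Summit.BirchSwinnertonDyer.BirchSwinnertonDyer.Theses.GenusKolyvaginAtTwo

/-- **glueR — the LINE-6 split glue of `KolyvaginExactAtTwo` threaded through Q5R.**
`CyclicTorsionOfNegDisc → KolyvaginRelationAtTwo → EquivariantChebotarevAtTwoR → Q3R →
KolyvaginExactAtTwoPosDisc → KolyvaginExactAtTwo`, where Q3R (the fourth antecedent, displayed) is the key
child Q3 `EquivariantKolyvaginExactAtTwo` with `EquivariantChebotarevAtTwoR` in place of the refuted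
`EquivariantChebotarevAtTwo`. Proof: an elliptic curve has `Δ ≠ 0`; on `Δ < 0` feed Q2, Q5R, Q1 to Q3R, on
`0 < Δ` use the residual Q4. [folklore] -/
theorem kolyvaginExactAtTwo_of_splitR :
    CyclicTorsionOfNegDisc → KolyvaginRelationAtTwo → EquivariantChebotarevAtTwoR →
    (KolyvaginRelationAtTwo → EquivariantChebotarevAtTwoR → (∀ (W : WeierstrassCurve ℚ) [W.IsElliptic], W.Δ < 0 → ∀ (c₀ : Field.absoluteGaloisGroup ℚ), Literature.NumberTheory.GaloisRepresentations.IsComplexConjugation (Rat.castHom ℝ) c₀ → ∀ (M : ℕ), ∃ P : W.geomTorsion ((2 ^ M : ℕ) : ℤ), ∀ Q : W.geomTorsion ((2 ^ M : ℕ) : ℤ), ∃ a b : ℤ, Q = a • P + b • (c₀ • P)) → ∀ (W : WeierstrassCurve ℚ) [W.IsElliptic] [W.IsGloballyMinimal] [NeZero (W.conductorNorm ℤ)], ¬ W.HasCM → W.Δ < 0 → ∀ (K : Type) [Field K] [NumberField K], Literature.NumberTheory.EllipticCurves.IsImaginaryQuadratic K → Odd (NumberField.discr K) → NumberField.discr K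 ≠ -3 → Literature.NumberTheory.EllipticCurves.SatisfiesHeegnerHypothesis (W.conductorNorm ℤ) K → ¬ IsSquare ((NumberField.discr K : ℚ) * -|W.Δ|) → ¬ IsSquare ((NumberField.discr K : ℚ) * (-(2 * |W.Δ|))) → (∀ n : ℕ, 0 < n → W.HasSurjectiveModNGaloisRep ((2 : ℤ) ^ n)) → ∀ (Dt : Literature.NumberTheory.EllipticCurves.ModularForms.ModularParametrizationData W (W.conductorNorm ℤ)) (β : ℤ) (ι : K →+* ℂ) (d₁ : Literature.NumberTheory.EllipticCurves.KolyvaginHeegnerData Dt β ι 1), ¬ IsOfFinAddOrder d₁.derivedPoint → ∀ (M₀ : ℕ), (∃ Q : (W.baseChange (Literature.NumberTheory.EllipticCurves.ringClassField K ι 1)).toAffine.Point, ((2 ^ M₀ : ℕ) : ℤ) • Q = d₁.derivedPoint) → (¬ ∃ Q : (W.baseChange (Literature.NumberTheory.EllipticCurves.ringClassField K ι 1)).toAffine.Point, ((2 ^ (M₀ + 1) : ℕ) : ℤ) • Q = d₁.derivedPoint) → ∀ (n : ℕ) (d : Literature.NumberTheory.EllipticCurves.KolyvaginHeegnerData Dt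 β ι n), Squarefree n → (∀ ℓ ∈ n.primeFactors, Literature.NumberTheory.EllipticCurves.Zhang2014.IsKolyvaginPrime (W.conductorNorm ℤ) W K 2 ℓ) → (¬ ∃ Q : (W.baseChange (Literature.NumberTheory.EllipticCurves.ringClassField K ι n)).toAffine.Point, (2 : ℤ) • Q = d.derivedPoint) → Nat.card (AddCommGroup.primaryComponent (W.baseChange K).sha 2) = 2 ^ (2 * M₀)) →
    KolyvaginExactAtTwoPosDisc → KolyvaginExactAtTwo := by
  intro hQ1 hQ2 hQ5R hQ3R hQ4 W _ _ _ hcm K _ _ hIQ hodd h3 hHe hsq1 hsq2 hρ Dt β ι d₁ hy M₀ hdiv hndiv n d hn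
    hKoly hPn
  have hΔ : W.Δ ≠ 0 := by rw [← WeierstrassCurve.coe_Δ']; exact W.Δ'.ne_zero
  rcases lt_or_gt_of_ne hΔ with hneg | hpos
  · exact hQ3R hQ2 hQ5R hQ1 W hcm hneg K hIQ hodd h3 hHe hsq1 hsq2 hρ Dt β ι d₁ hy M₀ hdiv hndiv n d hn
      hKoly hPn
  · exact hQ4 W hcm hpos K hIQ hodd h3 hHe hsq1 hsq2 hρ Dt β ι d₁ hy M₀ hdiv hndiv n d hn hKoly hPn

/-- **The parent crux `KolyvaginExactAtTwo` (22137) modulo its OPEN children only: Q2 → Q3R → Q4 → parent.**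
Q1 `CyclicTorsionOfNegDisc` is discharged by `GenusCyclicTorsion.cyclicTorsionOfNegDisc_proof` (item 24879,
proved) and Q5R `EquivariantChebotarevAtTwoR` by `GenusExact.equivariantChebotarevAtTwo_of_not_isSquare`
(item 27280's content, p606279). What remains displayed: Q2 `KolyvaginRelationAtTwo` (McCallum Prop. 4.4 at `2`),
Q3R (McCallum §5 at `2` on `Δ < 0`, the key child re-typed) and the residual Q4 (`0 < Δ`).
[cite: McCallumLMS1991, §3 Cor. 3.2 and §5] -/
theorem kolyvaginExactAtTwo_of_Q2_Q3R_Q4 :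
    KolyvaginRelationAtTwo →
    (KolyvaginRelationAtTwo → EquivariantChebotarevAtTwoR → (∀ (W : WeierstrassCurve ℚ) [W.IsElliptic], W.Δ < 0 → ∀ (c₀ : Field.absoluteGaloisGroup ℚ), Literature.NumberTheory.GaloisRepresentations.IsComplexConjugation (Rat.castHom ℝ) c₀ → ∀ (M : ℕ), ∃ P : W.geomTorsion ((2 ^ M : ℕ) : ℤ), ∀ Q : W.geomTorsion ((2 ^ M : ℕ) : ℤ), ∃ a b : ℤ, Q = a • P + b • (c₀ • P)) → ∀ (W : WeierstrassCurve ℚ) [W.IsElliptic] [W.IsGloballyMinimal] [NeZero (W.conductorNorm ℤ)], ¬ W.HasCM → W.Δ < 0 → ∀ (K : Type) [Field K] [NumberField K], Literature.NumberTheory.EllipticCurves.IsImaginaryQuadratic K → Odd (NumberField.discr K) → NumberField.discr K ≠ -3 → Literature.NumberTheory.EllipticCurves.SatisfiesHeegnerHypothesis (W.conductorNorm ℤ) K → ¬ IsSquare ((NumberField.discr K : ℚ) * -|W.Δ|) → ¬ IsSquare ((NumberField.discr K : ℚ) * (-(2 * |W.Δ|))) → (∀ n : ℕ, 0 < n → W.HasSurjectiveModNGaloisRep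 ((2 : ℤ) ^ n)) → ∀ (Dt : Literature.NumberTheory.EllipticCurves.ModularForms.ModularParametrizationData W (W.conductorNorm ℤ)) (β : ℤ) (ι : K →+* ℂ) (d₁ : Literature.NumberTheory.EllipticCurves.KolyvaginHeegnerData Dt β ι 1), ¬ IsOfFinAddOrder d₁.derivedPoint → ∀ (M₀ : ℕ), (∃ Q : (W.baseChange (Literature.NumberTheory.EllipticCurves.ringClassField K ι 1)).toAffine.Point, ((2 ^ M₀ : ℕ) : ℤ) • Q = d₁.derivedPoint) → (¬ ∃ Q : (W.baseChange (Literature.NumberTheory.EllipticCurves.ringClassField K ι 1)).toAffine.Point, ((2 ^ (M₀ + 1) : ℕ) : ℤ) • Q = d₁.derivedPoint) → ∀ (n : ℕ) (d : Literature.NumberTheory.EllipticCurves.KolyvaginHeegnerData Dt β ι n), Squarefree n → (∀ ℓ ∈ n.primeFactors, Literature.NumberTheory.EllipticCurves.Zhang2014.IsKolyvaginPrime (W.conductorNorm ℤ) W K 2 ℓ) → (¬ ∃ Q : (W.baseChange (Literature.NumberTheory.EllipticCurves.ringClassField K ι n)).toAffine.Point, (2 : ℤ) • Q = d.derivedPoint)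 → Nat.card (AddCommGroup.primaryComponent (W.baseChange K).sha 2) = 2 ^ (2 * M₀)) →
    KolyvaginExactAtTwoPosDisc → KolyvaginExactAtTwo := by
  intro hQ2 hQ3R hQ4
  refine kolyvaginExactAtTwo_of_splitR ?_ hQ2 ?_ hQ3R hQ4
  · exact Summit.BirchSwinnertonDyer.BirchSwinnertonDyer.Theorems.GenusCyclicTorsion.cyclicTorsionOfNegDisc_proof
  · intro N _ W _ _ hcm hΔ K _ _ hK hns hρ c hc M hM r cs π h0 hτs hind hres Mi hMi Nv hNe hNπ
    exact equivariantChebotarevAtTwo_of_not_isSquare N W hcm hΔ K hK hns hρ c hc M hM r cs π h0 hτs hind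
      hres Mi hMi Nv hNe hNπ

end Summit.BirchSwinnertonDyer.BirchSwinnertonDyer.Theorems.GenusExact
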